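import Mathlib
import Summits.ResolutionOfSingularities.ResolutionOfSingularities.Theorems.WeightedInvariantLocalWeightedDropTOT2BridgePresByEntry
import Summits.ResolutionOfSingularities.ResolutionOfSingularities.Theorems.WeightedInvariantLocalWeightedDropNCResPresentationAdapter
import Summits.ResolutionOfSingularities.ResolutionOfSingularities.Theorems.WeightedInvariantLocalWeightedDropNCResBadDirPosB

/-!
# `WeightedInvariant.LocalWeightedDrop` ENGINE, W′|₄ line — D₃ᴮ object (15): THE PRESENTED EXIT AND ENTRY HOLD FROM `o ≥ 1` WITH A NON-EMPTY HISTORY (hand D)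

Sub-problem `ResolutionOfSingularities`, ENGINE crux `stmt-ResolutionOfSingularities-8899` (`LocalWeightedDrop`), registered stub W′|₄
`stub_wildWideApexFourStartsWon`; res-L1-w43-plan-1 RULING 2026-08-27T21:45:42Z (D₃ᴮ lane), hand D (the `o = 1` phase; …NCResPhaseAssemblyPosB: what remains
of D₃ᴮ are regimes (P) (non-empty history) and (L) at order one).  [OURS · L1 W4.3 · chain w43 · res-L1-w43-lead-1 g6; def-free; nothing here is a statement
of any manuscript; AI-produced, gate-checked, weaker than expert review.]

THE ONE GENUINE USE OF `o ≥ 2` IN THE POLYGON REGIME is res-L1-w43-stub-2's `Decoration.newtonSet_nonempty_of_presentation` (…TOT2BridgePresentedExit): an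
empty Newton set makes `f ∘ Θ · (units) = H · y^o`, not square-free when `o ≥ 2`.  AT `o = 1` WITH A NON-EMPTY HISTORY the conclusion still holds: an old
letter `l₀` is straightened to `u · y`, so `y ∣ f ∘ Θ` pulls back along the inverse coordinate change to `x_{l₀} ∣ f` — against admissibility (A3).  (At
`o = 1` with EMPTY history it fails — `f` may be a coordinate — but those states are good positions, which exit by (T1) in …NCResPhaseAssemblyPosB.)  The
hypothesis used below is `1 ≤ o ∧ 2 ≤ c` (`c = o + |O|`).

* `Decoration.newtonSet_nonempty_of_presentation₁`, `Decoration.not_isPosT_of_presentation_of_not_inPoly₁`, `Decoration.hCol_of_presentation_of_not_inPoly₁`,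
  `Decoration.hCol_of_presBy_of_not_inPoly₁` — the exit reading `hPx` from `o ≥ 1`, `c ≥ 2`;
* `Decoration.exists_presBy_of_presented₁` — the entry record `hP1` from `o ≥ 1` for a NON-EMPTY history (the first branch of
  `Decoration.exists_presBy_of_presented` verbatim).
-/

set_option linter.dupNamespace false -- mandated namespace of this single-conjunct summit

noncomputable section

namespace Summit.ResolutionOfSingularities.ResolutionOfSingularities.Theorems

namespace TameFourTupleDrop

open MvPowerSeries Literature.AlgebraicGeometry.Resolution

variable {k : Type} [Field k]

section Presented

variable {b : MvPowerSeries (Fin (2 + 1)) k} {δ : Decoration k 2} {Θ : Fin (2 + 1) → MvPowerSeries (Fin (2 + 1)) k}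
  {H : MvPowerSeries (Fin (2 + 1)) k} {d : ℕ} {A : Fin d → MvPowerSeries (Fin 2) k}

/-- **FROM `o ≥ 1`, `c ≥ 2` A PRESENTED LABEL HAS NON-EMPTY NEWTON SET**: otherwise `f ∘ Θ · (units) = H · y^o`; at `o ≥ 2` this is not square-free
(`squarefree_subst_of_legal`), at `o = 1` the history is non-empty (`c ≥ 2`), an old letter `l₀` is straightened to `u · y`, and `y ∣ f ∘ Θ` pulls back along the
inverse of `Θ` to `x_{l₀} ∣ f`, against (A3). -/
theorem Decoration.newtonSet_nonempty_of_presentation₁ (hadm : Admissible b δ) (hΘ0 : ∀ i, constantCoeff (Θ i) = 0)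
    (hΘdet : IsUnit (FormalCoordChange.linMat Θ).det)
    (hΘE : ∀ l ∈ δ.E, ∃ (l' : Fin (2 + 1)) (u : MvPowerSeries (Fin (2 + 1)) k), constantCoeff u ≠ 0 ∧ Θ l = u * X l')
    (hH : constantCoeff H ≠ 0) (hpres : subst Θ (δ.f * ∏ l ∈ δ.O, X l) = H * NCPoly.monicGerm d A) (hcd : δ.c = d) (ho : 1 ≤ δ.o)
    (h2 : 2 ≤ δ.c) : (WildMonic.newtonSet A).Nonempty := by
  classical
  by_cases ho2 : 2 ≤ δ.o
  · exact Decoration.newtonSet_nonempty_of_presentation hadm hΘ0 hΘdet hΘE hH hpres hcd ho2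
  have ho1 : δ.o = 1 := by omega
  by_contra hne
  have hA : A = fun _ => 0 := PolyDescent.eq_zero_of_newtonSet_not_nonempty hne
  rw [hA] at hpres
  have hpres0 : subst Θ (δ.f * ∏ l ∈ δ.O, X l) = H * (X (Fin.last 2) ^ d +
      ∑ j : Fin d, rename (Fin.succAboveEmb (Fin.last 2)) ((fun _ : Fin d => (0 : MvPowerSeries (Fin 2) k)) j) * X (Fin.last 2) ^ (j : ℕ)) :=
    hpres
  rw [NCPoly.monicGerm_zero] at hpres
  have hperm : IsBPermissible δ Θ (fun _ => 1) := isBPermissible_point ⟨hΘ0, hΘdet, fun _ => le_rfl, ⟨0, Nat.one_pos⟩⟩ hΘE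
  have hΘs : HasSubst Θ := hasSubst_of_constantCoeff_zero hΘ0
  have hprime := MvPowerSeries.prime_X' k (Fin.last 2 : Fin (2 + 1))
  -- the old letters go to units times `y`
  have hstr : ∀ l ∈ δ.O, ∃ u : MvPowerSeries (Fin (2 + 1)) k, constantCoeff u ≠ 0 ∧ Θ l = u * X (Fin.last 2) := fun l hl =>
    exists_apply_eq_unit_mul_X_last_of_presentation hperm hH hpres0 hl
  choose! u hu using hstr
  have hprod : subst Θ (δ.f * ∏ l ∈ δ.O, X l) = subst Θ δ.f * (∏ l ∈ δ.O, u l) * X (Fin.last 2) ^ δ.O.card := by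
    rw [← coe_substAlgHom hΘs, map_mul, map_prod]
    have h : ∀ l ∈ δ.O, substAlgHom hΘs (X l : MvPowerSeries (Fin (2 + 1)) k) = u l * X (Fin.last 2) := fun l hl => by
      rw [coe_substAlgHom, subst_X hΘs]; exact (hu l hl).2
    rw [Finset.prod_congr rfl h, Finset.prod_mul_distrib, Finset.prod_const, coe_substAlgHom, mul_assoc]
  have hU0 : constantCoeff (∏ l ∈ δ.O, u l) ≠ 0 := by
    rw [map_prod]; exact Finset.prod_ne_zero_iff.mpr fun l hl => (hu l hl).1
  -- cancel `y^{|O|}`: `f ∘ Θ · U₀ = H · y`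
  have hdc : d = δ.o + δ.O.card := by rw [← hcd, Decoration.c]
  have hkey : subst Θ δ.f * (∏ l ∈ δ.O, u l) * X (Fin.last 2) ^ δ.O.card = H * X (Fin.last 2) ^ δ.o * X (Fin.last 2) ^ δ.O.card := by
    rw [← hprod, hpres, hdc, pow_add, mul_assoc]
  have hyne : (X (Fin.last 2) : MvPowerSeries (Fin (2 + 1)) k) ^ δ.O.card ≠ 0 := pow_ne_zero _ hprime.ne_zero
  have hkey' : subst Θ δ.f * ∏ l ∈ δ.O, u l = H * X (Fin.last 2) ^ δ.o := mul_right_cancel₀ hyne hkey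
  rw [ho1, pow_one] at hkey'
  -- `y ∣ f ∘ Θ`
  have hdvd1 : (X (Fin.last 2) : MvPowerSeries (Fin (2 + 1)) k) ∣ subst Θ δ.f * ∏ l ∈ δ.O, u l := by
    rw [hkey']; exact Dvd.intro_left H rfl
  have hdvd : (X (Fin.last 2) : MvPowerSeries (Fin (2 + 1)) k) ∣ subst Θ δ.f := by
    have hcop : ¬ X (Fin.last 2) ∣ ∏ l ∈ δ.O, u l := not_X_dvd_of_constantCoeff_ne_zero' _ hU0
    exact (hprime.dvd_or_dvd hdvd1).resolve_right hcop
  -- an old letter `l₀` (the history is non-empty since `c ≥ 2 > o = 1`) is straightened to `u · y`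
  have hOne : δ.O.Nonempty := by
    rw [← Finset.card_pos]
    have h := h2
    rw [Decoration.c, ho1] at h
    omega
  obtain ⟨l₀, hl₀⟩ := hOne
  obtain ⟨hu0, hΘl₀⟩ := hu l₀ hl₀
  have hdvd' : subst Θ (X l₀ : MvPowerSeries (Fin (2 + 1)) k) ∣ subst Θ δ.f := by
    rw [subst_X hΘs, hΘl₀]
    obtain ⟨q, hq⟩ := hdvd
    refine ⟨(u l₀)⁻¹ * q, ?_⟩
    rw [hq, mul_assoc, ← mul_assoc (X (Fin.last 2)) _ q, mul_comm (X (Fin.last 2)) ((u l₀)⁻¹), mul_assoc, ← mul_assoc (u l₀),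
      MvPowerSeries.mul_inv_cancel _ hu0, one_mul]
  -- pull back along the inverse coordinate change: `x_{l₀} ∣ f`, against (A3)
  obtain ⟨ψ, hψ0, hψΘ, -⟩ := FormalCoordChange.exists_comp_inverse hΘ0 hΘdet
  have hψs : HasSubst ψ := hasSubst_of_constantCoeff_zero hψ0
  have hback : ∀ φ : MvPowerSeries (Fin (2 + 1)) k, subst ψ (subst Θ φ) = φ := fun φ => by
    rw [subst_comp_subst_apply hΘs hψs, show (fun s => subst ψ (Θ s)) = X from funext hψΘ, subst_self]
    rfl
  have hfin : (X l₀ : MvPowerSeries (Fin (2 + 1)) k) ∣ δ.f := by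
    have h : subst ψ (subst Θ (X l₀ : MvPowerSeries (Fin (2 + 1)) k)) ∣ subst ψ (subst Θ δ.f) := by
      have h' := map_dvd (substAlgHom hψs) hdvd'
      rwa [coe_substAlgHom] at h'
    rwa [hback, hback] at h
  exact hadm.2.2 l₀ (δ.O_subset hl₀) hfin

/-- Hence from `o ≥ 1`, `c ≥ 2` a same-head presented label that has LEFT the regime (`¬ InPoly`) while well-prepared is NOT a position. -/
theorem Decoration.not_isPosT_of_presentation_of_not_inPoly₁ (hadm : Admissible b δ) (hΘ0 : ∀ i, constantCoeff (Θ i) = 0)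
    (hΘdet : IsUnit (FormalCoordChange.linMat Θ).det)
    (hΘE : ∀ l ∈ δ.E, ∃ (l' : Fin (2 + 1)) (u : MvPowerSeries (Fin (2 + 1)) k), constantCoeff u ≠ 0 ∧ Θ l = u * X l')
    (hH : constantCoeff H ≠ 0) (hpres : subst Θ (δ.f * ∏ l ∈ δ.O, X l) = H * NCPoly.monicGerm d A) (hcd : δ.c = d) (ho : 1 ≤ δ.o)
    (h2 : 2 ≤ δ.c) (hWP : PolyDescent.WellPrepared d A) (hn : ¬ PolyDescent.InPoly d A) : ¬ PolyDescent.IsPosT d A := fun hpos =>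
  hn ⟨hWP, hpos, Decoration.newtonSet_nonempty_of_presentation₁ hadm hΘ0 hΘdet hΘE hH hpres hcd ho h2⟩

/-- **THE SAME-HEAD EXIT, READ, FROM `o ≥ 1`, `c ≥ 2`** (`k` algebraically closed). -/
theorem Decoration.hCol_of_presentation_of_not_inPoly₁ [IsAlgClosed k] (hadm : Admissible b δ) (hΘ0 : ∀ i, constantCoeff (Θ i) = 0)
    (hΘdet : IsUnit (FormalCoordChange.linMat Θ).det)
    (hΘE : ∀ l ∈ δ.E, ∃ (l' : Fin (2 + 1)) (u : MvPowerSeries (Fin (2 + 1)) k), constantCoeff u ≠ 0 ∧ Θ l = u * X l')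
    (hH : constantCoeff H ≠ 0) (hd : 0 < d) (hpres : subst Θ (δ.f * ∏ l ∈ δ.O, X l) = H * NCPoly.monicGerm d A) (hcd : δ.c = d)
    (ho : 1 ≤ δ.o) (h2 : 2 ≤ δ.c) (hWP : PolyDescent.WellPrepared d A) (hn : ¬ PolyDescent.InPoly d A) : δ.HCol :=
  Decoration.hCol_of_presentation_of_not_isPosT hadm hΘ0 hΘdet hH hd hpres hcd hWP
    (Decoration.not_isPosT_of_presentation_of_not_inPoly₁ hadm hΘ0 hΘdet hΘE hH hpres hcd ho h2 hWP hn)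

/-- **THE EXIT READING `hPx` FROM `o ≥ 1`, `c ≥ 2`**, through the `PresBy` interface. -/
theorem Decoration.hCol_of_presBy_of_not_inPoly₁ [IsAlgClosed k] {N : Finset (Fin 2)} (hadm : Admissible b δ) (ho : 1 ≤ δ.o) (h2 : 2 ≤ δ.c)
    (hcd : δ.c = d) (hpres : δ.PresBy d A N Θ) (hWP : PolyDescent.WellPrepared d A) (hn : ¬ PolyDescent.InPoly d A) : δ.HCol := by
  obtain ⟨hperm, -, -, -, U, hU, hP⟩ := hpres
  have hd : 0 < d := by rw [← hcd]; omega
  exact Decoration.hCol_of_presentation_of_not_inPoly₁ hadm hperm.1.1 hperm.1.2.1 hperm.2.2.2 hU hd hP hcd ho h2 hWP hn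

end Presented

/-! ## The entry record from `o ≥ 1` with a non-empty history -/

section Entry

variable {b : MvPowerSeries (Fin (2 + 1)) k} {δ : Decoration k 2}

/-- **(P1) THE ENTRY RECORD FROM `o ≥ 1` WITH A NON-EMPTY HISTORY** (three letters, `k` infinite): an admissible state with `1 ≤ o`, outside the apex column,
with an old letter, is RECORDED (`PresBy`) by a label of degree `c` in the polygon regime — the first branch of `Decoration.exists_presBy_of_presented`. -/
theorem Decoration.exists_presBy_of_presented₁ [Infinite k] (hadm : Admissible b δ) (ho : 1 ≤ δ.o) (hnot : ¬ δ.HCol) (hO : δ.O.Nonempty) :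
    ∃ (A : Fin δ.c → MvPowerSeries (Fin 2) k) (N : Finset (Fin 2)) (Θ : Fin (2 + 1) → MvPowerSeries (Fin (2 + 1)) k),
      δ.PresBy δ.c A N Θ ∧ PolyDescent.InPoly δ.c A := by
  classical
  have h2 : 2 ≤ δ.c := by
    rw [Decoration.c]
    have := Finset.card_pos.mpr hO
    omega
  have hd : 0 < δ.c := by omega
  obtain ⟨ℓ, hℓ⟩ := Decoration.exists_isDirForm_of_not_hCol₁ hadm ho hnot
  obtain ⟨Θ, H, A, h0, hdet, hP3, hH, hA, hA0, hP⟩ := Decoration.exists_straightPresentation_of_isDirForm_of_O_nonempty hadm hℓ hO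
  have hmv : IsCountMove Θ (fun _ => 1) := ⟨h0, hdet, fun _ => le_rfl, ⟨0, Nat.one_pos⟩⟩
  have hperm := isBPermissible_point hmv hP3
  have hOl := strIdx_eq_last_of_presentation hperm hH hP
  refine ⟨A, Finset.univ.filter fun j : Fin 2 => ∃ l ∈ δ.E, l ∉ δ.O ∧ strIdx Θ l = Fin.castSucc j, Θ,
    ⟨hperm, hOl, fun l hl hlO => ?_, fun j hj => ?_, H, hH, hP⟩, ?_⟩
  · obtain ⟨l₀, hl₀⟩ := hO
    rcases Fin.eq_castSucc_or_eq_last (strIdx Θ l) with ⟨j, hj⟩ | hlast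
    · exact ⟨j, Finset.mem_filter.mpr ⟨Finset.mem_univ _, l, hl, hlO, hj⟩, hj⟩
    · exact absurd (strIdx_injOn hperm hl (δ.O_subset hl₀) (hlast.trans (hOl l₀ hl₀).symm) ▸ hl₀) hlO
  · obtain ⟨-, l, hl, hlO, hs⟩ := Finset.mem_filter.mp hj
    exact ⟨l, hl, hlO, hs⟩
  · exact ⟨PolyDescent.wellPrepared_of_apply_zero_eq_zero hd (hA0 hd), hA,
      Decoration.newtonSet_nonempty_of_presentation₁ hadm h0 hdet hP3 hH hP rfl ho h2⟩

end Entry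

end TameFourTupleDrop

end Summit.ResolutionOfSingularities.ResolutionOfSingularities.Theorems

end
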